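import Summits.RiemannHypothesis.RiemannHypothesis.Theorems.UniversalFactorMediumHighSums
import Summits.RiemannHypothesis.RiemannHypothesis.Theorems.UniversalFactorMediumHighTails

/-!
# RiemannHypothesis / UniversalFactor — `MediumKernelNoGo`, high window: soundness of the error terms

Route `RiemannHypothesis/UniversalFactor`, crux `MediumKernelNoGo` (stmt-RiemannHypothesis-2577), line
`one-sided-average-sign-test`, stub `stub_highWindow`.  For every `a` of a box `[A₁/AD, A₂/AD]`:
`hiCellErr_sound` (the rational cell bound dominates `M_disc · quadDefect + 2ρ·10⁻⁶·M_seg` of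
`stub_highCell` with `κ = ∓2a`), `hiSideErr_sound` (their sum), and `hiTails_sound` (the rational tail
bounds dominate the constants of `stub_highTailP/Q`, which decrease in `a`).
-/

set_option linter.dupNamespace false

namespace Summit.RiemannHypothesis.RiemannHypothesis.Theorems

open Real Finset Set MeasureTheory
open Literature.NumberTheory.LFunctions Literature.NumberTheory.LFunctions.ZetaNumerics
open Literature.Analysis.SpecialFunctions.Complex (stirlingPrim)
open Literature.Analysis.ValidatedNumerics Literature.Analysis.ValidatedNumerics.NumericsMP

/-- From `x ∈ X` and `exp X = some E`: `e^x ≤ E.hi / S`. [folklore] -/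
theorem UniversalFactor.hi_exp_le_hi {S : ℕ} (hS : 0 < S) {x : ℝ} {X E : MI}
    (hE : MI.exp S UniversalFactor.KEXP UniversalFactor.hiKexp X = some E) (hx : MI.mem S x X) :
    Real.exp x ≤ (E.hi : ℝ) / S := by
  have h := (MI.mem_exp hS hE hx).2
  have hSr : (0 : ℝ) < S := by exact_mod_cast hS
  rw [le_div_iff₀ hSr]; exact h

/-- `T_c + 1` is the cast of the rational `(Tn + Td)/Td`. [folklore] -/
theorem UniversalFactor.hiCellT_add_one {ρD : ℕ} (hρ : 0 < ρD) (fwd : Bool) (c : ℕ) :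
    (((UniversalFactor.hiCellTn ρD fwd c : ℤ) : ℝ) + (UniversalFactor.hiCellTd ρD : ℝ)) / (UniversalFactor.hiCellTd ρD : ℝ) =
      UniversalFactor.hiCellT ρD fwd c + 1 := by
  unfold UniversalFactor.hiCellT
  have hTd : (0 : ℝ) < UniversalFactor.hiCellTd ρD := by
    unfold UniversalFactor.hiCellTd UniversalFactor.lehmerT0D; exact_mod_cast (by positivity : 0 < ρD * 100)
  field_simp

/-- The signed `κ = ∓2a` of a side satisfies `−κ(T_c − t₀) = −2a(2c+1)/ρD` and `|κ| = 2a`. [folklore] -/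
theorem UniversalFactor.hiKappa_props {ρD : ℕ} (hρ : 0 < ρD) (fwd : Bool) (c : ℕ) {a : ℝ} (ha : 0 ≤ a) :
    -((if fwd then 2 * a else -(2 * a)) * (UniversalFactor.hiCellT ρD fwd c - UniversalFactor.lehmerT0)) =
        -(2 * a * ((2 * c + 1) / ρD)) ∧
      |(if fwd then 2 * a else -(2 * a))| = 2 * a := by
  rw [UniversalFactor.hiCellT_eq hρ]
  refine ⟨?_, ?_⟩
  · split_ifs <;> ring
  · split_ifs
    · exact abs_of_nonneg (by linarith)
    · rw [abs_neg]; exact abs_of_nonneg (by linarith)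

/-- **Soundness of `hiCellErr`**: for `a₁ ≤ a ≤ a₂` (`a_k = A_k/AD`, `a₁ ≥ 0`) and `κ = ∓2a`, the real
error constant of `stub_highCell` at cell `c` (with `D₀ ∈ d0`, `log T_c ∈ logT`) is at most the rational
bound. [folklore] -/
theorem UniversalFactor.hiCellErr_sound {S : ℕ} (hS : 0 < S) {ρD : ℕ} (hρ8 : 8 ≤ ρD) (fwd : Bool) {A₁ A₂ AD : ℕ} (hAD : 0 < AD)
    {c : ℕ} (hc : 2 * c + 1 ≤ 10 * ρD) {cell : UniversalFactor.HiCell} {D₀ : ℝ}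
    (hlog : MI.mem S (Real.log (UniversalFactor.hiCellT ρD fwd c)) cell.logT) (hd0 : MI.mem S D₀ cell.d0)
    {e : ℚ} (he : UniversalFactor.hiCellErr S ρD fwd A₁ A₂ AD c cell = some e)
    {a : ℝ} (h1 : (A₁ : ℝ) / AD ≤ a) (h2 : a ≤ (A₂ : ℝ) / AD) :
    UniversalFactor.lehmerMdisc UniversalFactor.lehmerT0 (if fwd then 2 * a else -(2 * a)) (UniversalFactor.hiCellT ρD fwd c) D₀ *
        UniversalFactor.quadDefect (Finset.range 16) (UniversalFactor.hiU ρD) (UniversalFactor.hiWt ρD) (1 / ρD) (1 / 4) 31 +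
      2 * (1 / ρD) * (1 / 10 ^ 6) *
        UniversalFactor.lehmerMseg UniversalFactor.lehmerT0 (if fwd then 2 * a else -(2 * a)) (UniversalFactor.hiCellT ρD fwd c) (1 / ρD) D₀ ≤ (e : ℝ) := by
  have hρ : 0 < ρD := lt_of_lt_of_le (by norm_num) hρ8
  have ha₁0 : (0 : ℝ) ≤ (A₁ : ℝ) / AD := by positivity
  have ha0 : 0 ≤ a := ha₁0.trans h1
  obtain ⟨hk1, hk2⟩ := UniversalFactor.hiKappa_props hρ fwd c ha0
  set κ : ℝ := (if fwd then 2 * a else -(2 * a)) with hκ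
  set T : ℝ := UniversalFactor.hiCellT ρD fwd c with hT
  unfold UniversalFactor.hiCellErr at he
  simp only at he
  split at he
  · rename_i ED ES hED hES
    simp only [Option.some.injEq] at he
    subst he
    have hSr : (0 : ℝ) < S := by exact_mod_cast hS
    have hρr : (0 : ℝ) < ρD := by exact_mod_cast hρ
    have hADr : (0 : ℝ) < AD := by exact_mod_cast hAD
    -- the two exponents and their enclosures
    set coefN : ℤ := (ρD : ℤ) - 4 * (2 * (c : ℤ) + 1) with hcoefN
    set Astar : ℕ := (if 0 ≤ coefN then A₂ else A₁) with hAstar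
    have hcoefR : ((coefN : ℤ) : ℝ) = (ρD : ℝ) - 4 * (2 * c + 1) := by rw [hcoefN]; push_cast; ring
    -- membership of the disc exponent
    have mL3 : MI.mem S (Real.log T + 3) (cell.logT.add (MI.ofInt S 3)) := by
      simpa using MI.mem_add hlog (MI.mem_ofInt S 3)
    have mXD : MI.mem S (1 / 4 + (Real.log T + 3) / 8 + D₀ + 2 * ((Astar : ℝ) / AD) * (coefN / (4 * ρD)))
        ((((MI.ofFrac S 1 4).add ((cell.logT.add (MI.ofInt S 3)).divNat 8)).add cell.d0).add
          (MI.ofFrac S (2 * (Astar : ℤ) * coefN) (4 * ρD * AD))) := by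
      have m1 : MI.mem S ((1 : ℝ) / 4) (MI.ofFrac S 1 4) := by simpa using MI.mem_ofFrac S 1 (q := 4) (by norm_num)
      have m2 := MI.mem_divNat mL3 (by norm_num : 0 < 8)
      have m4 : MI.mem S (2 * ((Astar : ℝ) / AD) * (coefN / (4 * ρD))) (MI.ofFrac S (2 * (Astar : ℤ) * coefN) (4 * ρD * AD)) := by
        have := MI.mem_ofFrac S (2 * (Astar : ℤ) * coefN) (q := 4 * ρD * AD) (by positivity)
        convert this using 1; push_cast; field_simp
      have := MI.mem_add (MI.mem_add (MI.mem_add m1 m2) hd0) m4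
      convert this using 1; push_cast; ring
    have mXS : MI.mem S ((Real.log T + 3) / (2 * ρD) + D₀ + -(4 * ((A₁ : ℝ) / AD) * c / ρD))
        ((((cell.logT.add (MI.ofInt S 3)).divNat (2 * ρD)).add cell.d0).add (MI.ofFrac S (-(4 * (A₁ : ℤ) * c)) (ρD * AD))) := by
      have m2 := MI.mem_divNat mL3 (by positivity : 0 < 2 * ρD)
      have m4 : MI.mem S (-(4 * ((A₁ : ℝ) / AD) * c / ρD)) (MI.ofFrac S (-(4 * (A₁ : ℤ) * c)) (ρD * AD)) := by
        have := MI.mem_ofFrac S (-(4 * (A₁ : ℤ) * c)) (q := ρD * AD) (by positivity)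
        convert this using 1; push_cast; field_simp
      have := MI.mem_add (MI.mem_add m2 hd0) m4
      convert this using 1; push_cast; ring
    have eD := UniversalFactor.hi_exp_le_hi hS hED mXD
    have eS := UniversalFactor.hi_exp_le_hi hS hES mXS
    -- the true exponents are at most the enclosed ones
    have hdisc_exp : 1 / 4 + (Real.log T + 3) * (1 / 4) / 2 + D₀ + (-κ * (T - UniversalFactor.lehmerT0) + |κ| * (1 / 4)) ≤
        1 / 4 + (Real.log T + 3) / 8 + D₀ + 2 * ((Astar : ℝ) / AD) * (coefN / (4 * ρD)) := by
      have e1 : -κ * (T - UniversalFactor.lehmerT0) + |κ| * (1 / 4) = 2 * a * (coefN / (4 * ρD)) := by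
        rw [neg_mul, hk1, hk2, hcoefR]; field_simp; ring
      rw [e1]
      have hmono : 2 * a * ((coefN : ℝ) / (4 * ρD)) ≤ 2 * ((Astar : ℝ) / AD) * (coefN / (4 * ρD)) := by
        rw [hAstar]
        split_ifs with hc0
        · have : (0 : ℝ) ≤ coefN / (4 * ρD) := by
            apply div_nonneg (by exact_mod_cast hc0) (by positivity)
          nlinarith
        · have : (coefN : ℝ) / (4 * ρD) ≤ 0 := by
            apply div_nonpos_of_nonpos_of_nonneg (by exact_mod_cast (not_le.1 hc0).le) (by positivity)
          nlinarith
      linarith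
    have hseg_exp : (Real.log T + 3) * (1 / ρD) / 2 + D₀ + (-κ * (T - UniversalFactor.lehmerT0) + |κ| * (1 / ρD)) ≤
        (Real.log T + 3) / (2 * ρD) + D₀ + -(4 * ((A₁ : ℝ) / AD) * c / ρD) := by
      have e1 : -κ * (T - UniversalFactor.lehmerT0) + |κ| * (1 / ρD) = -(4 * a * c / ρD) := by
        rw [neg_mul, hk1, hk2]; field_simp; ring
      rw [e1]
      have hc0 : (0 : ℝ) ≤ c := Nat.cast_nonneg c
      have : 4 * ((A₁ : ℝ) / AD) * c / ρD ≤ 4 * a * c / ρD := by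
        apply div_le_div_of_nonneg_right _ hρr.le; nlinarith
      have e2 : (Real.log T + 3) * (1 / ρD) / 2 = (Real.log T + 3) / (2 * ρD) := by field_simp
      linarith
    -- assemble
    have hT1 := UniversalFactor.hiCellT_add_one hρ fwd c
    have hTpos1 : 0 ≤ T + 1 := by
      rw [hT, UniversalFactor.hiCellT_eq hρ]
      have hle : (2 * (c : ℝ) + 1) / ρD ≤ 10 := by
        rw [div_le_iff₀ hρr]; exact_mod_cast hc
      have hge : (0 : ℝ) ≤ (2 * (c : ℝ) + 1) / ρD := by positivity
      unfold UniversalFactor.lehmerT0 UniversalFactor.lehmerT0N UniversalFactor.lehmerT0D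
      split_ifs <;> push_cast <;> linarith
    have hqD := UniversalFactor.hiDefectQ_cast ρD
    have hqD0 : 0 ≤ UniversalFactor.quadDefect (Finset.range 16) (UniversalFactor.hiU ρD) (UniversalFactor.hiWt ρD) (1 / ρD) (1 / 4) 31 := by
      unfold UniversalFactor.quadDefect
      have hρ8r : (8 : ℝ) ≤ ρD := by exact_mod_cast hρ8
      have hr : (1 : ℝ) / ρD / (1 / 4) ≤ 1 / 2 := by
        rw [div_le_iff₀ (by norm_num : (0:ℝ) < 1 / 4), div_le_iff₀ hρr]; linarith
      have hr0 : (0 : ℝ) ≤ 1 / ρD / (1 / 4) := by positivity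
      have h1 : (0 : ℝ) ≤ 1 - 1 / ρD / (1 / 4) := by linarith
      positivity
    have hM : UniversalFactor.lehmerMdisc UniversalFactor.lehmerT0 κ T D₀ ≤ 5 * (T + 1) ^ 3 * ((ED.hi : ℝ) / S) := by
      unfold UniversalFactor.lehmerMdisc
      have h5 : (0 : ℝ) ≤ 5 * (T + 1) ^ 3 := mul_nonneg (by norm_num) (pow_nonneg hTpos1 3)
      exact mul_le_mul_of_nonneg_left ((Real.exp_le_exp.2 hdisc_exp).trans eD) h5
    have hMs : UniversalFactor.lehmerMseg UniversalFactor.lehmerT0 κ T (1 / ρD) D₀ ≤ 253 / 10 * (T + 1) ^ 2 * ((ES.hi : ℝ) / S) := by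
      unfold UniversalFactor.lehmerMseg
      have h5 : (0 : ℝ) ≤ 253 / 10 * (T + 1) ^ 2 := by positivity
      exact mul_le_mul_of_nonneg_left ((Real.exp_le_exp.2 hseg_exp).trans eS) h5
    have hfin := add_le_add (mul_le_mul_of_nonneg_right hM hqD0)
      (mul_le_mul_of_nonneg_left hMs (by positivity : (0 : ℝ) ≤ 2 * (1 / ρD) * (1 / 10 ^ 6)))
    refine hfin.trans (le_of_eq ?_)
    rw [← hqD]
    push_cast
    rw [hT1]
  · simp at he

/-- **Soundness of `hiSideErr`**: the sum of the real cell error constants over the first `n` cells is at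
most the rational bound. [folklore] -/
theorem UniversalFactor.hiSideErr_sound {S : ℕ} (hS : 0 < S) {ρD : ℕ} (hρ8 : 8 ≤ ρD) (fwd : Bool) {A₁ A₂ AD : ℕ} (hAD : 0 < AD)
    {cells : List UniversalFactor.HiCell} (D₀ : ℕ → ℝ) {N : ℕ} (hN : 2 * N ≤ 10 * ρD + 1)
    (hlog : ∀ c < N, MI.mem S (Real.log (UniversalFactor.hiCellT ρD fwd c)) (cells.getD c UniversalFactor.hiCell0).logT)
    (hd0 : ∀ c < N, MI.mem S (D₀ c) (cells.getD c UniversalFactor.hiCell0).d0)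
    {a : ℝ} (h1 : (A₁ : ℝ) / AD ≤ a) (h2 : a ≤ (A₂ : ℝ) / AD) :
    ∀ n ≤ N, ∀ {e : ℚ}, UniversalFactor.hiSideErr S ρD fwd A₁ A₂ AD cells n = some e →
      ∑ c ∈ Finset.range n,
        (UniversalFactor.lehmerMdisc UniversalFactor.lehmerT0 (if fwd then 2 * a else -(2 * a)) (UniversalFactor.hiCellT ρD fwd c) (D₀ c) *
            UniversalFactor.quadDefect (Finset.range 16) (UniversalFactor.hiU ρD) (UniversalFactor.hiWt ρD) (1 / ρD) (1 / 4) 31 +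
          2 * (1 / ρD) * (1 / 10 ^ 6) *
            UniversalFactor.lehmerMseg UniversalFactor.lehmerT0 (if fwd then 2 * a else -(2 * a)) (UniversalFactor.hiCellT ρD fwd c) (1 / ρD) (D₀ c))
        ≤ (e : ℝ)
  | 0, _, e, h => by
      simp only [UniversalFactor.hiSideErr, Option.some.injEq] at h
      subst h; simp
  | n + 1, hn, e, h => by
      simp only [UniversalFactor.hiSideErr] at h
      split at h
      · rename_i e' x he' hx
        simp only [Option.some.injEq] at h
        subst h
        have ih := UniversalFactor.hiSideErr_sound hS hρ8 fwd hAD D₀ hN hlog hd0 h1 h2 n (by omega) he'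
        have hc : n < N := by omega
        have hcell := UniversalFactor.hiCellErr_sound hS hρ8 fwd hAD (c := n) (by omega) (hlog n hc) (hd0 n hc) hx h1 h2
        rw [Finset.sum_range_succ]
        push_cast
        linarith
      · simp at h

/-- `e^{−rY}/r` decreases in `r > 0` (`Y ≥ 0`). [folklore] -/
theorem UniversalFactor.hi_exp_div_antitone {r₁ r Y : ℝ} (hr₁ : 0 < r₁) (hr : r₁ ≤ r) (hY : 0 ≤ Y) :
    Real.exp (-(r * Y)) / r ≤ Real.exp (-(r₁ * Y)) / r₁ := by
  have hr0 : 0 < r := lt_of_lt_of_le hr₁ hr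
  have h1 : Real.exp (-(r * Y)) ≤ Real.exp (-(r₁ * Y)) := Real.exp_le_exp.2 (by nlinarith)
  calc Real.exp (-(r * Y)) / r ≤ Real.exp (-(r₁ * Y)) / r := div_le_div_of_nonneg_right h1 hr0.le
    _ ≤ Real.exp (-(r₁ * Y)) / r₁ := div_le_div_of_nonneg_left (Real.exp_pos _).le hr₁ hr

/-- A successful `divPos` has a positive divisor. [folklore] -/
theorem UniversalFactor.hi_divPos_lo_pos {S : ℕ} {I J K : MI} (h : MI.divPos S I J = some K) : 0 < J.lo := by
  by_contra h0
  unfold MI.divPos at h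
  rw [if_neg h0] at h
  simp at h

/-- The constant `A = C(t₀)(t₀+1)³` of the tails lies in the interval computed by `hiTails`. [folklore] -/
theorem UniversalFactor.hiTailConst_mem {C : UniversalFactor.LCtx} (hC : C.Valid) {LN LD EC : MI}
    (hLN : MI.logNat C.T.S C.Klog UniversalFactor.lehmerT0N = some LN)
    (hLD : MI.logNat C.T.S C.Klog (2 * UniversalFactor.lehmerT0D) = some LD)
    (hEC : MI.exp C.T.S UniversalFactor.KEXP UniversalFactor.kEXP
      ((((LN.sub LD).divNat 4).add (MI.ofFrac C.T.S 67 64)).add (C.T.piI.divNat 4)) = some EC) :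
    MI.mem C.T.S (UniversalFactor.lehmerTailConst UniversalFactor.lehmerT0 * (UniversalFactor.lehmerT0 + 1) ^ 3)
      (MI.mul C.T.S (EC.mulInt 5)
        (MI.ofFrac C.T.S (((UniversalFactor.lehmerT0N + UniversalFactor.lehmerT0D) ^ 3 : ℕ) : ℤ) (UniversalFactor.lehmerT0D ^ 3))) := by
  have hS := hC.tv.S_pos
  have hpi := hC.tv.mem_pi
  have m1 := MI.mem_logNat hS hLN
  have m2 := MI.mem_logNat hS hLD
  have mex : MI.mem C.T.S (Real.log (UniversalFactor.lehmerT0 / 2) / 4 + 3 / 64 + Real.pi / 4 + 1)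
      ((((LN.sub LD).divNat 4).add (MI.ofFrac C.T.S 67 64)).add (C.T.piI.divNat 4)) := by
    have := MI.mem_add (MI.mem_add (MI.mem_divNat (MI.mem_sub m1 m2) (by norm_num : 0 < 4))
      (MI.mem_ofFrac C.T.S 67 (q := 64) (by norm_num))) (MI.mem_divNat hpi (by norm_num : 0 < 4))
    convert this using 1
    unfold UniversalFactor.lehmerT0 UniversalFactor.lehmerT0N UniversalFactor.lehmerT0D
    rw [← Real.log_div (by norm_num) (by norm_num)]
    push_cast
    ring_nf
  have mC : MI.mem C.T.S (UniversalFactor.lehmerTailConst UniversalFactor.lehmerT0) (EC.mulInt 5) := by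
    have := MI.mem_mulInt (MI.mem_exp hS hEC mex) 5
    unfold UniversalFactor.lehmerTailConst
    convert this using 1; push_cast; ring
  have mT : MI.mem C.T.S ((UniversalFactor.lehmerT0 + 1) ^ 3)
      (MI.ofFrac C.T.S (((UniversalFactor.lehmerT0N + UniversalFactor.lehmerT0D) ^ 3 : ℕ) : ℤ) (UniversalFactor.lehmerT0D ^ 3)) := by
    have := MI.mem_ofFrac C.T.S (((UniversalFactor.lehmerT0N + UniversalFactor.lehmerT0D) ^ 3 : ℕ) : ℤ)
      (q := UniversalFactor.lehmerT0D ^ 3) (by unfold UniversalFactor.lehmerT0D; positivity)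
    convert this using 1
    unfold UniversalFactor.lehmerT0 UniversalFactor.lehmerT0N UniversalFactor.lehmerT0D
    push_cast; norm_num
  exact MI.mem_mul hS mC mT

/-- **Soundness of `hiTails`**: for every `a ≥ a₁ = A₁/AD ≥ 1` the tail constants of `stub_highTailP`
(`Y = 4CyB/ρD`) and `stub_highTailQ` (`Y = 4CyF/ρD`) are at most `tP`, `tQ`. [folklore] -/
theorem UniversalFactor.hiTails_sound {C : UniversalFactor.LCtx} (hC : C.Valid) {ρD CyB CyF A₁ AD : ℕ} (hρ : 0 < ρD) (hAD : 0 < AD)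
    (hA₁ : AD ≤ A₁) {tP tQ : ℚ} (h : UniversalFactor.hiTails C ρD CyB CyF A₁ AD = some (tP, tQ))
    {a : ℝ} (h1 : (A₁ : ℝ) / AD ≤ a) :
    UniversalFactor.lehmerTailConst UniversalFactor.lehmerT0 * (UniversalFactor.lehmerT0 + 1) ^ 3 *
          Real.exp (-((a - Real.pi / 8) * (4 * CyB / ρD))) / (a - Real.pi / 8) + 1 ≤ (tP : ℝ) ∧
      UniversalFactor.lehmerTailConst UniversalFactor.lehmerT0 * (UniversalFactor.lehmerT0 + 1) ^ 3 *
          Real.exp (-(a * (4 * CyF / ρD))) / a ≤ (tQ : ℝ) := by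
  have hS := hC.tv.S_pos
  have hSr : (0 : ℝ) < C.T.S := by exact_mod_cast hS
  have hpi := hC.tv.mem_pi
  have hρr : (0 : ℝ) < ρD := by exact_mod_cast hρ
  have hADr : (0 : ℝ) < AD := by exact_mod_cast hAD
  have ha₁ : (1 : ℝ) ≤ (A₁ : ℝ) / AD := by
    rw [le_div_iff₀ hADr, one_mul]; exact_mod_cast hA₁
  set a₁ : ℝ := (A₁ : ℝ) / AD with ha₁def
  set A : ℝ := UniversalFactor.lehmerTailConst UniversalFactor.lehmerT0 * (UniversalFactor.lehmerT0 + 1) ^ 3 with hAdef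
  have hA0 : 0 ≤ A := by
    rw [hAdef]; unfold UniversalFactor.lehmerTailConst UniversalFactor.lehmerT0 UniversalFactor.lehmerT0N UniversalFactor.lehmerT0D
    positivity
  unfold UniversalFactor.hiTails at h
  simp only at h
  split at h
  · rename_i LN LD hLN hLD
    split at h
    · rename_i EC hEC
      split at h
      · rename_i E1 E2 hE1 hE2
        split at h
        · rename_i Q1 hQ1
          simp only [Option.some.injEq, Prod.mk.injEq] at h
          obtain ⟨htP, htQ⟩ := h
          have mA := UniversalFactor.hiTailConst_mem hC hLN hLD hEC
          rw [← hAdef] at mA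
          -- `r₁ = a₁ − π/8 > 0`
          have mr : MI.mem C.T.S (a₁ - Real.pi / 8) ((MI.ofFrac C.T.S (A₁ : ℤ) AD).sub (C.T.piI.divNat 8)) := by
            have := MI.mem_sub (MI.mem_ofFrac C.T.S (A₁ : ℤ) (q := AD) hAD) (MI.mem_divNat hpi (by norm_num : 0 < 8))
            simpa [ha₁def] using this
          have hr₁ : 0 < a₁ - Real.pi / 8 := by
            have hlo : 0 < ((MI.ofFrac C.T.S (A₁ : ℤ) AD).sub (C.T.piI.divNat 8)).lo := UniversalFactor.hi_divPos_lo_pos hQ1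
            have := mr.1
            have hlo' : (0 : ℝ) < (((MI.ofFrac C.T.S (A₁ : ℤ) AD).sub (C.T.piI.divNat 8)).lo : ℝ) := by exact_mod_cast hlo
            nlinarith
          refine ⟨?_, ?_⟩
          · -- backward tail
            rw [← htP]
            have mE1 : MI.mem C.T.S (Real.exp (-((a₁ - Real.pi / 8) * (4 * CyB / ρD)))) E1 := by
              refine MI.mem_exp hS hE1 ?_
              have := MI.mem_add (MI.mem_ofFrac C.T.S (-(4 * (CyB : ℤ) * A₁)) (q := ρD * AD) (by positivity))
                (MI.mem_divNat (MI.mem_mulInt hpi (CyB : ℤ)) (by positivity : 0 < 2 * ρD))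
              convert this using 1
              rw [ha₁def]; push_cast; field_simp; ring
            have mQ := MI.mem_divPos hS hQ1 (MI.mem_mul hS mA mE1) mr
            have hle : A * Real.exp (-((a₁ - Real.pi / 8) * (4 * CyB / ρD))) / (a₁ - Real.pi / 8) ≤ (Q1.hi : ℝ) / C.T.S := by
              rw [le_div_iff₀ hSr]; exact mQ.2
            have hmono := UniversalFactor.hi_exp_div_antitone hr₁ (by linarith : a₁ - Real.pi / 8 ≤ a - Real.pi / 8)
              (by positivity : (0:ℝ) ≤ 4 * CyB / ρD)
            have : A * Real.exp (-((a - Real.pi / 8) * (4 * CyB / ρD))) / (a - Real.pi / 8) ≤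
                A * Real.exp (-((a₁ - Real.pi / 8) * (4 * CyB / ρD))) / (a₁ - Real.pi / 8) :=
              calc A * Real.exp (-((a - Real.pi / 8) * (4 * CyB / ρD))) / (a - Real.pi / 8)
                  = A * (Real.exp (-((a - Real.pi / 8) * (4 * CyB / ρD))) / (a - Real.pi / 8)) := mul_div_assoc _ _ _
                _ ≤ A * (Real.exp (-((a₁ - Real.pi / 8) * (4 * CyB / ρD))) / (a₁ - Real.pi / 8)) :=
                    mul_le_mul_of_nonneg_left hmono hA0
                _ = _ := (mul_div_assoc _ _ _).symm
            push_cast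
            linarith
          · -- forward tail
            rw [← htQ]
            have ha₁pos : 0 < a₁ := by linarith
            have mE2 : MI.mem C.T.S (Real.exp (-(a₁ * (4 * CyF / ρD)))) E2 := by
              refine MI.mem_exp hS hE2 ?_
              have := MI.mem_ofFrac C.T.S (-(4 * (CyF : ℤ) * A₁)) (q := ρD * AD) (by positivity)
              convert this using 1
              rw [ha₁def]; push_cast; field_simp
            have mAE := MI.mem_mul hS mA mE2
            set H : ℤ := (MI.mul C.T.S (MI.mul C.T.S (EC.mulInt 5)
                (MI.ofFrac C.T.S (((UniversalFactor.lehmerT0N + UniversalFactor.lehmerT0D) ^ 3 : ℕ) : ℤ) (UniversalFactor.lehmerT0D ^ 3))) E2).hi with hH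
            have hle : A * Real.exp (-(a₁ * (4 * CyF / ρD))) ≤ (H : ℝ) / C.T.S := by
              rw [le_div_iff₀ hSr]; exact mAE.2
            have hmono := UniversalFactor.hi_exp_div_antitone ha₁pos h1 (by positivity : (0:ℝ) ≤ 4 * CyF / ρD)
            have h3 : A * Real.exp (-(a * (4 * CyF / ρD))) / a ≤ A * Real.exp (-(a₁ * (4 * CyF / ρD))) / a₁ :=
              calc A * Real.exp (-(a * (4 * CyF / ρD))) / a = A * (Real.exp (-(a * (4 * CyF / ρD))) / a) := mul_div_assoc _ _ _
                _ ≤ A * (Real.exp (-(a₁ * (4 * CyF / ρD))) / a₁) := mul_le_mul_of_nonneg_left hmono hA0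
                _ = _ := (mul_div_assoc _ _ _).symm
            have h4 : A * Real.exp (-(a₁ * (4 * CyF / ρD))) / a₁ ≤ (H : ℝ) / C.T.S / a₁ :=
              div_le_div_of_nonneg_right hle ha₁pos.le
            have hA₁r : (0 : ℝ) < A₁ := by exact_mod_cast (lt_of_lt_of_le hAD hA₁)
            have h5 : (H : ℝ) / C.T.S / a₁ = (H : ℝ) / C.T.S * AD / A₁ := by
              rw [ha₁def]; field_simp
            push_cast
            linarith [h5]
        · simp at h
      · simp at h
    · simp at h
  · simp at h

/-- **Registered anchor `stub_hiErr`** of this file (monotonicity of the tail constant). [folklore] -/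
theorem UniversalFactor.stub_hiErr :
    ∀ (r₁ r Y : ℝ), 0 < r₁ → r₁ ≤ r → 0 ≤ Y → Real.exp (-(r * Y)) / r ≤ Real.exp (-(r₁ * Y)) / r₁ :=
  fun _ _ _ h1 h2 h3 => UniversalFactor.hi_exp_div_antitone h1 h2 h3

end Summit.RiemannHypothesis.RiemannHypothesis.Theorems
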